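import Summits.Parity.BatemanHorn.Theses.RoughParitySectors

/-!
# Route `RoughParitySectors`: the support item `RoughCountBand` (stmt-Parity-15630), PROVED, and the
# two calibrations of the jointly rough set used by the exactness package of crux
# `OddSectorShareNonlinear` (stmt-Parity-15628)

Everything is PROVED from the tree, for EVERY Bateman–Horn system `f` (`m = C(f)/∏deg fᵢ`, jointly
rough set `R_f(x,U) = {1 ≤ n ≤ x : ∀ i, fᵢ(n) > 0, no prime p < ⌈x^{deg fᵢ/U}⌉₊ divides fᵢ(n)}`,
prime cell `c₁(x,U) = #{n ∈ R : ∀ i, Ω(fᵢ(n)) = 1}`; predicates verbatim the route's):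

* `primeCell_le_polyPrimeCount_le` — bookkeeping `c₁ ≤ polyPrimeCount f x ≤ c₁ + (1 + max Mᵢ) +
  2⌈x^{1/4}⌉₊` for `U ≥ 4·max deg fᵢ + 1`, `x ≥ 2` (the comparison that is a local `have` in the
  route's deciding theorem `Theses.RoughParitySectors.closes`);
* `primeCell_calibration` — under `BatemanHornAsymptotic f`: `|c₁·(log x)^k − m·x| ≤ τ·x` eventually,
  for every `τ > 0` and every `U ≥ 4·max deg fᵢ + 1`;
* `roughCard_calibration` — `|#R·(log x)^k − x·m·e^{−kγ}U^k| ≤ τ·x·m·e^{−kγ}U^k` for `U ≥ U₀(τ)`,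
  eventually in `x`: the landed two-sided fundamental-lemma band
  `Cruxes.RoughValueLaw.IncrementAnchoring.stub_sieveBand` (`|#R − xV| ≤ τ'xV`) times the staggered
  Mertens calibration `Theorems.SieveCalibration.tendsto_log_pow_mul_staggeredProd`
  (`(log x)^k·V → m·e^{−kγ}U^k`), `τ' = min(τ,1)/3`;
* `roughCountBand_proof : Theses.RoughParitySectors.RoughCountBand` — the support item BY NAME
  (`roughCard_calibration` divided by `x`);
* `two_pow_mul_shareBase_pow` — `2^k·(U e^{−γ}/2)^k = e^{−kγ}·U^k` (the identity linking the band
  constant to the share base of the cruxes `OddSectorShare*`).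

References: Bateman–Horn, Math. Comp. 16 (1962) (1)–(2) [BatemanHorn1962]; Halberstam–Richert,
*Sieve Methods* (1974), Thm 2.5 (fundamental lemma) [HalberstamRichert1974]; Lichtman 2025 (linear
sieve with staggered thresholds) [Lichtman2025LinearSieve].
-/

namespace Summit.Parity.BatemanHorn.Theorems.RoughCountBand

open Filter Finset Polynomial
open scoped Topology
open Literature.NumberTheory.Sieve

/-! ### §2 Bookkeeping: the prime cell versus `polyPrimeCount`

(Adapted from the route's `closes`, where the same comparison is a local `have`.)  For
`U ≥ 4·max deg fᵢ + 1` and `x ≥ 2`: the prime cell lies in the `polyPrimeCount` set (`Ω(m) = 1 ↔ m`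
prime), and an `n` counted by `polyPrimeCount` lies in the prime cell unless `n < 1 + max Mᵢ` or
`n < 2⌈x^{1/4}⌉₊` — otherwise a prime `p < ⌈x^{deg fᵢ/U}⌉₊ ≤ ⌈x^{1/4}⌉₊` dividing the prime `fᵢ(n)`
equals it and `n ≤ n^{deg fᵢ} ≤ 2fᵢ(n) = 2p < 2⌈x^{1/4}⌉₊ ≤ n`. -/

/-- `c₁(x,U) ≤ polyPrimeCount f x ≤ c₁(x,U) + (1 + max Mᵢ) + 2⌈x^{1/4}⌉₊` for `U ≥ 4·max deg fᵢ + 1`,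
`x ≥ 2`, where `Mᵢ` are growth thresholds `n^{deg fᵢ} ≤ 2fᵢ(n)` (`n ≥ Mᵢ`). [folklore] -/
theorem primeCell_le_polyPrimeCount_le {k : ℕ} {f : Fin k → ℤ[X]} (hf : IsBatemanHornSystem f)
    (M : Fin k → ℕ) (hM : ∀ i n, M i ≤ n → (n : ℤ) ^ (f i).natDegree ≤ 2 * (f i).eval (n : ℤ))
    (U : ℝ) (x : ℕ) (hU : 4 * ((univ.sup fun i => (f i).natDegree : ℕ) : ℝ) + 1 ≤ U)
    (hx : 2 ≤ x) :
    #(((Icc 1 x).filter (fun n : ℕ => ∀ i, 0 < (f i).eval (n : ℤ) ∧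
        ∀ p ∈ range ⌈(x : ℝ) ^ (((f i).natDegree : ℝ) / U)⌉₊, p.Prime →
          ¬ ((p : ℤ) ∣ (f i).eval (n : ℤ)))).filter
        (fun n : ℕ => ∀ i, ArithmeticFunction.cardFactors (((f i).eval (n : ℤ)).toNat) = 1)) ≤
      polyPrimeCount f x ∧
    polyPrimeCount f x ≤
      #(((Icc 1 x).filter (fun n : ℕ => ∀ i, 0 < (f i).eval (n : ℤ) ∧
        ∀ p ∈ range ⌈(x : ℝ) ^ (((f i).natDegree : ℝ) / U)⌉₊, p.Prime →
          ¬ ((p : ℤ) ∣ (f i).eval (n : ℤ)))).filter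
        (fun n : ℕ => ∀ i, ArithmeticFunction.cardFactors (((f i).eval (n : ℤ)).toNat) = 1)) +
        (1 + univ.sup M) + 2 * ⌈(x : ℝ) ^ (1 / 4 : ℝ)⌉₊ := by
  have hdS : ∀ i, ((f i).natDegree : ℝ) ≤ (univ.sup fun i => (f i).natDegree : ℕ) := fun i => by
    exact_mod_cast Finset.le_sup (f := fun i => (f i).natDegree) (mem_univ i)
  have hP' : polyPrimeCount f x = #((range (x + 1)).filter
      fun n : ℕ => ∀ i, 0 < (f i).eval (n : ℤ) ∧ ((f i).eval (n : ℤ)).toNat.Prime) := by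
    unfold polyPrimeCount; congr
  rw [hP']
  have hx1 : (1 : ℝ) ≤ x := by exact_mod_cast (by omega : 1 ≤ x)
  have hU0 : 0 < U := by
    linarith [Nat.cast_nonneg (α := ℝ) (univ.sup fun i => (f i).natDegree)]
  constructor
  · exact card_le_card fun n hn => by
      rw [mem_filter, mem_filter, mem_Icc] at hn
      exact mem_filter.2 ⟨mem_range.2 (by omega), fun i => ⟨(hn.1.2 i).1,
        ArithmeticFunction.cardFactors_eq_one_iff_prime.1 (hn.2 i)⟩⟩
  · set s := ((Icc 1 x).filter (fun n : ℕ => ∀ i, 0 < (f i).eval (n : ℤ) ∧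
        ∀ p ∈ range ⌈(x : ℝ) ^ (((f i).natDegree : ℝ) / U)⌉₊, p.Prime →
          ¬ ((p : ℤ) ∣ (f i).eval (n : ℤ)))).filter
        (fun n : ℕ => ∀ i, ArithmeticFunction.cardFactors (((f i).eval (n : ℤ)).toNat) = 1) with hs
    have hsub : (range (x + 1)).filter
        (fun n : ℕ => ∀ i, 0 < (f i).eval (n : ℤ) ∧ ((f i).eval (n : ℤ)).toNat.Prime) ⊆
        s ∪ (range (1 + univ.sup M) ∪ range (2 * ⌈(x : ℝ) ^ (1 / 4 : ℝ)⌉₊)) := by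
      intro n hn
      rw [mem_filter, mem_range] at hn
      obtain ⟨hnx, hn⟩ := hn
      by_contra hc
      rw [mem_union, mem_union, mem_range, mem_range, not_or, not_or, not_lt, not_lt] at hc
      obtain ⟨hc, hKn, hZn⟩ := hc
      refine hc (mem_filter.2 ⟨mem_filter.2 ⟨mem_Icc.2 ⟨by omega, by omega⟩,
        fun i => ⟨(hn i).1, fun p hp hpp hpd => ?_⟩⟩,
        fun i => ArithmeticFunction.cardFactors_eq_one_iff_prime.2 (hn i).2⟩)
      obtain ⟨h0, hq⟩ := hn i
      have hpq : p = ((f i).eval (n : ℤ)).toNat := (Nat.prime_dvd_prime_iff_eq hpp hq).1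
        (by rwa [← Int.natCast_dvd_natCast, Int.toNat_of_nonneg h0.le])
      have hpe : (p : ℤ) = (f i).eval (n : ℤ) := by rw [hpq, Int.toNat_of_nonneg h0.le]
      have h1 := hM i n ((Finset.le_sup (f := M) (mem_univ i)).trans (by omega))
      have h2 : (n : ℤ) ≤ (n : ℤ) ^ (f i).natDegree := by
        exact_mod_cast Nat.le_self_pow (hf.natDegree_pos i).ne' n
      have h3 : p < ⌈(x : ℝ) ^ (1 / 4 : ℝ)⌉₊ := (mem_range.1 hp).trans_le (Nat.ceil_mono
        (Real.rpow_le_rpow_of_exponent_le hx1 (by rw [div_le_iff₀ hU0]; linarith [hdS i])))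
      omega
    calc #((range (x + 1)).filter
          (fun n : ℕ => ∀ i, 0 < (f i).eval (n : ℤ) ∧ ((f i).eval (n : ℤ)).toNat.Prime))
        ≤ #(s ∪ (range (1 + univ.sup M) ∪ range (2 * ⌈(x : ℝ) ^ (1 / 4 : ℝ)⌉₊))) :=
          card_le_card hsub
      _ ≤ #s + (#(range (1 + univ.sup M)) + #(range (2 * ⌈(x : ℝ) ^ (1 / 4 : ℝ)⌉₊))) :=
          (card_union_le _ _).trans (Nat.add_le_add_left (card_union_le _ _) _)
      _ = #s + (1 + univ.sup M) + 2 * ⌈(x : ℝ) ^ (1 / 4 : ℝ)⌉₊ := by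
          rw [card_range, card_range]; ring

/-! ### §3 Calibration of the prime cell under `BatemanHornAsymptotic f` -/

/-- **Prime-cell calibration.**  If `f` is a Bateman–Horn system satisfying the Bateman–Horn
asymptotic, then for every `τ > 0` and every `U ≥ 4·max deg fᵢ + 1`, eventually in `x`,
`|c₁(x,U)·(log x)^k − m·x| ≤ τ·x` with `m = C(f)/∏ deg fᵢ`.  (`polyPrimeCount ∼ m·x/(log x)^k`,
and `0 ≤ polyPrimeCount − c₁ ≤ 1 + max Mᵢ + 2⌈x^{1/4}⌉₊ = o(x/(log x)^k)`.) [folklore] -/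
theorem primeCell_calibration {k : ℕ} {f : Fin k → ℤ[X]} (hf : IsBatemanHornSystem f)
    (hBH : BatemanHornAsymptotic f) :
    ∀ τ : ℝ, 0 < τ → ∀ U : ℝ, 4 * ((univ.sup fun i => (f i).natDegree : ℕ) : ℝ) + 1 ≤ U →
      ∀ᶠ x : ℕ in atTop,
        |(#(((Icc 1 x).filter (fun n : ℕ => ∀ i, 0 < (f i).eval (n : ℤ) ∧
            ∀ p ∈ range ⌈(x : ℝ) ^ (((f i).natDegree : ℝ) / U)⌉₊, p.Prime →
              ¬ ((p : ℤ) ∣ (f i).eval (n : ℤ)))).filter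
            (fun n : ℕ => ∀ i, ArithmeticFunction.cardFactors (((f i).eval (n : ℤ)).toNat) = 1)) : ℝ) *
            Real.log x ^ k -
          batemanHornConst f / (∏ i, ((f i).natDegree : ℝ)) * x| ≤ τ * x := by
  intro τ hτ U hU
  obtain ⟨hC, hC0⟩ := IsBatemanHornSystem.hasBatemanHornConst_holds hf
  obtain ⟨C, hCC, hequiv⟩ := hBH
  have hCeq : C = batemanHornConst f := (hCC.batemanHornConst_eq).symm
  subst hCeq
  set m : ℝ := batemanHornConst f / ∏ i, ((f i).natDegree : ℝ) with hm
  have hm0 : 0 < m := div_pos hC0 (prod_pos fun i _ => by exact_mod_cast hf.natDegree_pos i)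
  -- growth thresholds
  choose M hM using fun i =>
    Theorems.BalancedSemiprimeLayer.Negative.exists_pow_le_two_mul_eval (hf.leadingCoeff_pos i)
  -- the Bateman–Horn asymptotic as an eventual relative band with tolerance `τ/(2m)·m = τ/2`
  have hBH' : ∀ᶠ x : ℕ in atTop,
      |(polyPrimeCount f x : ℝ) - m * x / Real.log x ^ k| ≤ τ / (2 * m) * |m * x / Real.log x ^ k| := by
    have h := hequiv.isLittleO
    rw [Asymptotics.isLittleO_iff] at h
    have h' := h (c := τ / (2 * m)) (by positivity)
    filter_upwards [h'] with x hx
    simp only [Pi.sub_apply, Real.norm_eq_abs, Fintype.card_fin] at hx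
    have e : m * x / Real.log x ^ k = batemanHornConst f / (∏ i, ((f i).natDegree : ℝ)) * x /
        Real.log x ^ k := by rw [hm]
    rw [e]
    exact hx
  -- the bookkeeping error is `o(x/(log x)^k)`
  have habs := Cruxes.RoughValueLaw.IncrementAnchoring.SieveBand.eventually_absorb k
    (univ.sup M + 3) (by positivity : 0 < τ / 4)
  filter_upwards [hBH', habs, eventually_ge_atTop 2] with x hBx habsx hx2
  obtain ⟨hE1, hE2⟩ := primeCell_le_polyPrimeCount_le hf M hM U x hU hx2
  set c₁ : ℕ := #(((Icc 1 x).filter (fun n : ℕ => ∀ i, 0 < (f i).eval (n : ℤ) ∧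
      ∀ p ∈ range ⌈(x : ℝ) ^ (((f i).natDegree : ℝ) / U)⌉₊, p.Prime →
        ¬ ((p : ℤ) ∣ (f i).eval (n : ℤ)))).filter
      (fun n : ℕ => ∀ i, ArithmeticFunction.cardFactors (((f i).eval (n : ℤ)).toNat) = 1)) with hc₁
  have hx1 : (1 : ℝ) ≤ x := by exact_mod_cast (by omega : 1 ≤ x)
  have hX : (0 : ℝ) < x := by linarith
  have hL0 : 0 < Real.log x ^ k := pow_pos (Real.log_pos (by exact_mod_cast hx2)) k
  -- (a) `|pPC·L − m x| ≤ (τ/2)·x`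
  have hP : |(polyPrimeCount f x : ℝ) * Real.log x ^ k - m * x| ≤ τ / 2 * x := by
    have e1 : (polyPrimeCount f x : ℝ) * Real.log x ^ k - m * x =
        ((polyPrimeCount f x : ℝ) - m * x / Real.log x ^ k) * Real.log x ^ k := by
      field_simp
    rw [e1, abs_mul, abs_of_pos hL0]
    calc |(polyPrimeCount f x : ℝ) - m * x / Real.log x ^ k| * Real.log x ^ k
        ≤ τ / (2 * m) * |m * x / Real.log x ^ k| * Real.log x ^ k :=
          mul_le_mul_of_nonneg_right hBx hL0.le
      _ = τ / 2 * x := by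
          rw [abs_of_pos (by positivity : (0 : ℝ) < m * x / Real.log x ^ k)]
          field_simp
  -- (b) the bookkeeping error `E = (1 + max M) + 2⌈x^{1/4}⌉₊` has `E·L ≤ (τ/2)·x`
  have hE : (((1 + univ.sup M : ℕ) : ℝ) + ((2 * ⌈(x : ℝ) ^ (1 / 4 : ℝ)⌉₊ : ℕ) : ℝ)) *
      Real.log x ^ k ≤ τ / 2 * x := by
    have hr1 : (1 : ℝ) ≤ (x : ℝ) ^ (1 / 4 : ℝ) := Real.one_le_rpow hx1 (by norm_num)
    have hr2 : (x : ℝ) ^ (1 / 4 : ℝ) ≤ ((x : ℝ) ^ (1 / 4 : ℝ)) ^ 2 := by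
      rw [sq]; exact le_mul_of_one_le_left (by positivity) hr1
    have hZ : (⌈(x : ℝ) ^ (1 / 4 : ℝ)⌉₊ : ℝ) ≤ (x : ℝ) ^ (1 / 4 : ℝ) + 1 :=
      (Nat.ceil_lt_add_one (by positivity)).le
    have hsum : ((1 + univ.sup M : ℕ) : ℝ) + ((2 * ⌈(x : ℝ) ^ (1 / 4 : ℝ)⌉₊ : ℕ) : ℝ) ≤
        2 * (((univ.sup M + 3 : ℕ) : ℝ) + ((x : ℝ) ^ (1 / 4 : ℝ)) ^ 2) := by
      push_cast
      nlinarith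
    calc (((1 + univ.sup M : ℕ) : ℝ) + ((2 * ⌈(x : ℝ) ^ (1 / 4 : ℝ)⌉₊ : ℕ) : ℝ)) * Real.log x ^ k
        ≤ 2 * (((univ.sup M + 3 : ℕ) : ℝ) + ((x : ℝ) ^ (1 / 4 : ℝ)) ^ 2) * Real.log x ^ k :=
          mul_le_mul_of_nonneg_right hsum hL0.le
      _ = 2 * ((((univ.sup M + 3 : ℕ) : ℝ) + ((x : ℝ) ^ (1 / 4 : ℝ)) ^ 2) * Real.log x ^ k) := by
          ring
      _ ≤ 2 * (τ / 4 * x) := mul_le_mul_of_nonneg_left habsx (by norm_num)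
      _ = τ / 2 * x := by ring
  -- (c) combine: `c₁ ≤ pPC ≤ c₁ + E`
  have hE1' : (c₁ : ℝ) * Real.log x ^ k ≤ (polyPrimeCount f x : ℝ) * Real.log x ^ k :=
    mul_le_mul_of_nonneg_right (by exact_mod_cast hE1) hL0.le
  have hE2' : (polyPrimeCount f x : ℝ) * Real.log x ^ k ≤
      ((c₁ : ℝ) + ((1 + univ.sup M : ℕ) : ℝ) + ((2 * ⌈(x : ℝ) ^ (1 / 4 : ℝ)⌉₊ : ℕ) : ℝ)) *
        Real.log x ^ k := by
    refine mul_le_mul_of_nonneg_right ?_ hL0.le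
    exact_mod_cast hE2
  rw [abs_le] at hP ⊢
  constructor <;> linarith [hP.1, hP.2, hE1', hE2', hE]

/-! ### §4 Calibration of the rough count (the proved band × staggered Mertens) -/

/-- `(2·(U e^{−γ}/2))^k = e^{−kγ}·U^k`. [folklore] -/
theorem two_pow_mul_shareBase_pow (k : ℕ) (U : ℝ) :
    (2 : ℝ) ^ k * (U * Real.exp (-Real.eulerMascheroniConstant) / 2) ^ k =
      Real.exp (-((k : ℝ) * Real.eulerMascheroniConstant)) * U ^ k := by
  rw [neg_mul_eq_mul_neg, Real.exp_nat_mul, ← mul_pow, ← mul_pow]; congr 1; ring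

/-- **Rough-count calibration** (the support item `RoughCountBand` up to normalisation, PROVED from
the tree): for every Bateman–Horn system `f` and every `τ > 0` there is `U₀` such that for every
`U ≥ U₀`, eventually in `x`, `|#R_f(x,U)·(log x)^k − x·B_U| ≤ τ·x·B_U` with
`B_U = (C(f)/∏deg fᵢ)·e^{−kγ}·U^k`.  Proof: the band `stub_sieveBand` (`|#R − xV| ≤ τ'xV`) and
`tendsto_log_pow_mul_staggeredProd` (`(log x)^k V → B_U`) with `τ' = min(τ,1)/3`. [folklore] -/
theorem roughCard_calibration {k : ℕ} {f : Fin k → ℤ[X]} (hf : IsBatemanHornSystem f) :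
    ∀ τ : ℝ, 0 < τ → ∃ U₀ : ℝ, ∀ U : ℝ, U₀ ≤ U → ∀ᶠ x : ℕ in atTop,
      |(#((Icc 1 x).filter (fun n : ℕ => ∀ i, 0 < (f i).eval (n : ℤ) ∧
          ∀ p ∈ range ⌈(x : ℝ) ^ (((f i).natDegree : ℝ) / U)⌉₊, p.Prime →
            ¬ ((p : ℤ) ∣ (f i).eval (n : ℤ)))) : ℝ) * Real.log x ^ k -
        x * (batemanHornConst f / (∏ i, ((f i).natDegree : ℝ)) *
          Real.exp (-((k : ℝ) * Real.eulerMascheroniConstant)) * U ^ k)| ≤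
      τ * (x * (batemanHornConst f / (∏ i, ((f i).natDegree : ℝ)) *
          Real.exp (-((k : ℝ) * Real.eulerMascheroniConstant)) * U ^ k)) := by
  intro τ hτ
  obtain ⟨_, hC0⟩ := IsBatemanHornSystem.hasBatemanHornConst_holds hf
  have hm0 : 0 < batemanHornConst f / ∏ i, ((f i).natDegree : ℝ) :=
    div_pos hC0 (prod_pos fun i _ => by exact_mod_cast hf.natDegree_pos i)
  set τ' : ℝ := min τ 1 / 3 with hτ'
  have hτ'0 : 0 < τ' := by positivity
  have hτ'1 : τ' ≤ 1 / 3 := by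
    rw [hτ']; linarith [min_le_right τ 1]
  have hτ'τ : 3 * τ' ≤ τ := by
    rw [hτ']; linarith [min_le_left τ 1]
  obtain ⟨U₃, h₃⟩ := Cruxes.RoughValueLaw.IncrementAnchoring.stub_sieveBand k f hf τ' hτ'0
  refine ⟨max U₃ (((univ.sup fun i => (f i).natDegree : ℕ) : ℝ) + 1), fun U hU => ?_⟩
  have hU₃ : U₃ ≤ U := le_trans (le_max_left _ _) hU
  have hUd : ∀ i, ((f i).natDegree : ℝ) ≤ U := fun i => by
    have h1 : ((f i).natDegree : ℝ) ≤ ((univ.sup fun i => (f i).natDegree : ℕ) : ℝ) := by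
      exact_mod_cast Finset.le_sup (f := fun i => (f i).natDegree) (mem_univ i)
    linarith [le_trans (le_max_right _ _) hU]
  have hU0 : 0 < U := by
    have := le_trans (le_max_right _ _) hU
    linarith [Nat.cast_nonneg (α := ℝ) (univ.sup fun i => (f i).natDegree)]
  have hV := Theorems.SieveCalibration.tendsto_log_pow_mul_staggeredProd k f hf U hUd
  set B : ℝ := batemanHornConst f / (∏ i, ((f i).natDegree : ℝ)) *
    Real.exp (-((k : ℝ) * Real.eulerMascheroniConstant)) * U ^ k with hB
  have hB0 : 0 < B := by rw [hB]; positivity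
  filter_upwards [h₃ U hU₃, Metric.tendsto_nhds.1 hV _ (mul_pos hτ'0 hB0), eventually_ge_atTop 2]
    with x hband hmert hx2
  set V : ℝ := ∏ p ∈ Nat.primesBelow (x + 1),
    (1 - (#((range p).filter (fun r : ℕ => ∃ i,
      (p : ℝ) < (x : ℝ) ^ (((f i).natDegree : ℝ) / U) ∧ (p : ℤ) ∣ (f i).eval (r : ℤ))) : ℝ) /
        (p : ℝ)) with hVdef
  set R : ℝ := (#((Icc 1 x).filter (fun n : ℕ => ∀ i, 0 < (f i).eval (n : ℤ) ∧
      ∀ p ∈ range ⌈(x : ℝ) ^ (((f i).natDegree : ℝ) / U)⌉₊, p.Prime →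
        ¬ ((p : ℤ) ∣ (f i).eval (n : ℤ)))) : ℝ) with hRdef
  set L : ℝ := Real.log x ^ k with hLdef
  have hX : (0 : ℝ) < x := by exact_mod_cast (by omega : 0 < x)
  have hL0 : 0 < L := pow_pos (Real.log_pos (by exact_mod_cast hx2)) k
  rw [Real.dist_eq] at hmert
  obtain ⟨hb1, hb2⟩ := abs_le.1 hband
  obtain ⟨hm1, hm2⟩ := abs_le.1 hmert.le
  -- `R L ∈ [(1-τ') xVL, (1+τ') xVL]` and `xVL ∈ [(1-τ') xB, (1+τ') xB]`
  have hRL_lo : (1 - τ') * (x * V) * L ≤ R * L :=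
    mul_le_mul_of_nonneg_right (by linarith) hL0.le
  have hRL_hi : R * L ≤ (1 + τ') * (x * V) * L :=
    mul_le_mul_of_nonneg_right (by linarith) hL0.le
  have hxLV_lo : (1 - τ') * ((1 - τ') * B) * x ≤ (1 - τ') * (L * V) * x :=
    mul_le_mul_of_nonneg_right (mul_le_mul_of_nonneg_left (by linarith) (by linarith)) hX.le
  have hxLV_hi : (1 + τ') * (L * V) * x ≤ (1 + τ') * ((1 + τ') * B) * x :=
    mul_le_mul_of_nonneg_right (mul_le_mul_of_nonneg_left (by linarith) (by linarith)) hX.le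
  have hs1 : τ' ^ 2 * (x * B) ≤ τ' * (x * B) := by
    have : τ' ^ 2 ≤ τ' := by nlinarith
    exact mul_le_mul_of_nonneg_right this (by positivity)
  have hs2 : 0 ≤ τ' ^ 2 * (x * B) := by positivity
  have hs3 : 3 * τ' * (x * B) ≤ τ * (x * B) := mul_le_mul_of_nonneg_right hτ'τ (by positivity)
  refine abs_le.2 ⟨?_, ?_⟩ <;> linarith

/-! ### §5 The support item `RoughCountBand` (stmt-Parity-15630) -/

/-- **`RoughCountBand` (support item stmt-Parity-15630 of route `RoughParitySectors`), PROVED**: for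
every Bateman–Horn system `f` and `ε > 0` there is `U₀` such that for every `U ≥ U₀`, eventually in `x`,
`|#R_f(x,U)·(log x)^k/x − c_f·U^k| ≤ ε·c_f·U^k` with `c_f = (C(f)/∏deg fᵢ)·e^{−kγ}` — the calibrated
two-sided fundamental-lemma band of the jointly rough set (`roughCard_calibration` divided by `x`).
[folklore] -/
theorem roughCountBand_proof : Summit.Parity.BatemanHorn.Theses.RoughParitySectors.RoughCountBand := by
  intro k f hf ε hε
  obtain ⟨U₀, hU₀⟩ := roughCard_calibration hf ε hε
  refine ⟨U₀, fun U hU => ?_⟩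
  filter_upwards [hU₀ U hU, eventually_ge_atTop 1] with x hx hx1
  have hX : (0 : ℝ) < x := by exact_mod_cast (by omega : 0 < x)
  have key : ∀ R L B : ℝ, |R * L - x * B| ≤ ε * (x * B) → |R * L / x - B| ≤ ε * B := by
    intro R L B h
    have e : R * L / x - B = (R * L - x * B) / x := by field_simp
    rw [e, abs_div, abs_of_pos hX, div_le_iff₀ hX]
    calc _ ≤ _ := h
      _ = _ := by ring
  exact key _ _ _ hx

end Summit.Parity.BatemanHorn.Theorems.RoughCountBand
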